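import Summits.ResolutionOfSingularities.ResolutionOfSingularities.Theses.FrobeniusLadder
import Summits.ResolutionOfSingularities.ResolutionOfSingularities.Theorems.FrobeniusLadderFRationalModificationCmCartierHull
import Summits.ResolutionOfSingularities.ResolutionOfSingularities.Theorems.FRationalModification.Negative.LoadBearing
import Literature.AlgebraicGeometry.Resolution.MacaulayficationOverCMLocus
import Literature.AlgebraicGeometry.Resolution.AlterationsNormalizationReduction
import Literature.AlgebraicGeometry.Resolution.ComponentGluing
import Mathlib.AlgebraicGeometry.IdealSheaf.Functorial
import HarnessLib

/-!
# The two promotion signatures of line `birth`'s open stub agree modulo Macaulayfication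
(crux `FrobeniusLadder.FRationalModification`, stmt-ResolutionOfSingularities-15316, line `birth` v3.4)

Line `birth` closes the crux `FRationalModification` modulo ONE open geometric statement, the
F-injective Cartier hull, which comes in two forms:

* the REGISTERED stub `stub_fInjectiveCartierHull` (CM form): the ambient `W` is integral separated of
  finite type over `k` AND all its stalks are Cohen–Macaulay; given an effective Cartier `D` with `W`
  regular off `Supp D`, produce a proper birational `W' → W` and an effective Cartier `D'` with `W'`
  regular off `Supp D'` and, on `Supp D'`, domain stalks with `𝒪_{W',w}/D'_w` Cohen–Macaulay and
  F-injective;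
* the CM-FREE form (hypothesis `hFIH` of the tree's
  `HullsNoCM.fRationalModification_of_fInjectiveCartierHull`, chain B): the same with the Cohen–Macaulay
  hypothesis on `W` dropped — it implies the crux with NO named fact.

The CM-free form trivially implies the CM form (`fInjectiveCartierHull_of_noCM`). This file proves the
converse MODULO the ladder's single named fact `CesnaviciusMacaulayfication` (Česnavičius 2021, Thm. 1.6:
a proper birational integral Cohen–Macaulay model that is an isomorphism over every open with
Cohen–Macaulay stalks): Macaulayfy the ambient `W₁ → W`; since `W` is regular, hence Cohen–Macaulay, off
`Supp D`, the Macaulayfication is an isomorphism over `W ∖ Supp D`; the boundary pulls back to an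
effective Cartier divisor `D₁ = D·𝒪_{W₁}` along the dominant `W₁ → W` (de Jong 1996, 4.10, tree
`IsEffectiveCartier.comap_of_isDominant`), `W₁` is regular off `Supp D₁ = π₁⁻¹ Supp D` by transport
along the stalk isomorphisms, and the CM form applies to `(W₁, D₁)`; compose. So the planners may
promote EITHER signature: they are equivalent modulo the one theorem in print the ladder already cites,
and the CM form hands the constructor a Cohen–Macaulay ambient (along a Cartier boundary of which the
boundary ring is Cohen–Macaulay for free).

## References

* K. Česnavičius, *Macaulayfication of Noetherian schemes*, Duke Math. J. 170 (2021), Thm. 1.6.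
  [Cesnavicius2021]
* A. J. de Jong, *Smoothness, semi-stability and alterations*, Publ. Math. IHÉS 83 (1996), 4.10.
  [DeJong1996]
* H. Matsumura, *Commutative Ring Theory* (1986), Thm. 17.4 (iii), 17.8 (regular ⇒ Cohen–Macaulay).
  [Matsumura1987]
-/

-- single-problem summit: the doubled namespace component `ResolutionOfSingularities` is forced
set_option linter.dupNamespace false

noncomputable section

open CategoryTheory AlgebraicGeometry TopologicalSpace IsLocalRing
open Literature.AlgebraicGeometry.Resolution
open Summit.ResolutionOfSingularities.ResolutionOfSingularities.Theses.FrobeniusLadder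

namespace Summit.ResolutionOfSingularities.ResolutionOfSingularities.Theorems.FRationalModification.MacaulayfyHull

/-- **CM-free form ⇒ CM form** of the F-injective Cartier hull (forget the Cohen–Macaulay hypothesis on
the ambient). [folklore] -/
theorem fInjectiveCartierHull_of_noCM
    (hFIH : ∀ (p : ℕ) [Fact p.Prime] (k : Type) [Field k] [CharP k p] (W : Scheme.{0})
      (g : W ⟶ Spec (.of k)) [IsSeparated g] [LocallyOfFiniteType g] [QuasiCompact g] [IsIntegral W]
      (D : W.IdealSheafData), IsEffectiveCartier D →
        (∀ w : W, w ∉ D.support → IsRegularLocalRing (W.presheaf.stalk w)) →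
        ∃ (W' : Scheme.{0}) (π : W' ⟶ W), IsProper π ∧ IsBirational π ∧
          ∃ D' : W'.IdealSheafData, IsEffectiveCartier D' ∧
            (∀ w : W', w ∉ D'.support → IsRegularLocalRing (W'.presheaf.stalk w)) ∧
            (∀ w : W', w ∈ D'.support → IsDomain (W'.presheaf.stalk w) ∧
              ∀ d : ℕ, ringKrullDim (W'.presheaf.stalk w ⧸ stalkIdeal D' w) = d →
                ∀ t : Fin d → W'.presheaf.stalk w ⧸ stalkIdeal D' w,
                  (Ideal.span (Set.range t)).radical.IsMaximal →
                    RingTheory.Sequence.IsWeaklyRegular (W'.presheaf.stalk w ⧸ stalkIdeal D' w)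
                      (List.ofFn t) ∧
                    ∀ y : W'.presheaf.stalk w ⧸ stalkIdeal D' w, (∃ e : ℕ, y ^ p ^ e ∈
                      Ideal.span ((fun z : W'.presheaf.stalk w ⧸ stalkIdeal D' w => z ^ p ^ e) ''
                        (Ideal.span (Set.range t) :
                          Set (W'.presheaf.stalk w ⧸ stalkIdeal D' w)))) →
                      y ∈ Ideal.span (Set.range t)))
    (p : ℕ) [Fact p.Prime] (k : Type) [Field k] [CharP k p] (W : Scheme.{0})
    (g : W ⟶ Spec (.of k)) [IsSeparated g] [LocallyOfFiniteType g] [QuasiCompact g] [IsIntegral W]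
    (_hCM : ∀ w : W, ∀ d : ℕ, ringKrullDim (W.presheaf.stalk w) = d →
      ∀ s : Fin d → W.presheaf.stalk w, (Ideal.span (Set.range s)).radical.IsMaximal →
        RingTheory.Sequence.IsWeaklyRegular (W.presheaf.stalk w) (List.ofFn s))
    (D : W.IdealSheafData) (hD : IsEffectiveCartier D)
    (hreg : ∀ w : W, w ∉ D.support → IsRegularLocalRing (W.presheaf.stalk w)) :
    ∃ (W' : Scheme.{0}) (π : W' ⟶ W), IsProper π ∧ IsBirational π ∧
      ∃ D' : W'.IdealSheafData, IsEffectiveCartier D' ∧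
        (∀ w : W', w ∉ D'.support → IsRegularLocalRing (W'.presheaf.stalk w)) ∧
        (∀ w : W', w ∈ D'.support → IsDomain (W'.presheaf.stalk w) ∧
          ∀ d : ℕ, ringKrullDim (W'.presheaf.stalk w ⧸ stalkIdeal D' w) = d →
            ∀ t : Fin d → W'.presheaf.stalk w ⧸ stalkIdeal D' w,
              (Ideal.span (Set.range t)).radical.IsMaximal →
                RingTheory.Sequence.IsWeaklyRegular (W'.presheaf.stalk w ⧸ stalkIdeal D' w)
                  (List.ofFn t) ∧
                ∀ y : W'.presheaf.stalk w ⧸ stalkIdeal D' w, (∃ e : ℕ, y ^ p ^ e ∈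
                  Ideal.span ((fun z : W'.presheaf.stalk w ⧸ stalkIdeal D' w => z ^ p ^ e) ''
                    (Ideal.span (Set.range t) : Set (W'.presheaf.stalk w ⧸ stalkIdeal D' w)))) →
                  y ∈ Ideal.span (Set.range t)) :=
  hFIH p k W g D hD hreg

/-- **CM form + Macaulayfication ⇒ CM-free form** of the F-injective Cartier hull. Given the CM form
(`hFIH`, line `birth`'s registered `stub_fInjectiveCartierHull`) and Česnavičius's Macaulayfication that
is an isomorphism over the Cohen–Macaulay locus (`hM`), every effective Cartier `D` on an arbitrary
INTEGRAL separated finite-type `W/k` with `W` regular off `Supp D` has an F-injective Cartier hull: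
Macaulayfy `π₁ : W₁ → W` (an isomorphism over `W ∖ Supp D`, whose stalks are regular, hence
Cohen–Macaulay: Matsumura Thm. 17.8), pull `D` back to the effective Cartier `D·𝒪_{W₁}` along the
dominant `π₁` (de Jong 1996, 4.10), transport regularity off it along the stalk isomorphisms, apply the
CM form to `(W₁, D·𝒪_{W₁})`, and compose the two proper birational morphisms.
[cite: Cesnavicius2021, Thm. 1.6; DeJong1996, 4.10; Matsumura1987, Thm. 17.8] -/
theorem fInjectiveCartierHullNoCM_of_macaulayfication (hM : CesnaviciusMacaulayfication.{0})
    (hFIH : ∀ (p : ℕ) [Fact p.Prime] (k : Type) [Field k] [CharP k p] (W : Scheme.{0})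
      (g : W ⟶ Spec (.of k)) [IsSeparated g] [LocallyOfFiniteType g] [QuasiCompact g] [IsIntegral W],
      (∀ w : W, ∀ d : ℕ, ringKrullDim (W.presheaf.stalk w) = d →
        ∀ s : Fin d → W.presheaf.stalk w, (Ideal.span (Set.range s)).radical.IsMaximal →
          RingTheory.Sequence.IsWeaklyRegular (W.presheaf.stalk w) (List.ofFn s)) →
      ∀ (D : W.IdealSheafData), IsEffectiveCartier D →
        (∀ w : W, w ∉ D.support → IsRegularLocalRing (W.presheaf.stalk w)) →
        ∃ (W' : Scheme.{0}) (π : W' ⟶ W), IsProper π ∧ IsBirational π ∧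
          ∃ D' : W'.IdealSheafData, IsEffectiveCartier D' ∧
            (∀ w : W', w ∉ D'.support → IsRegularLocalRing (W'.presheaf.stalk w)) ∧
            (∀ w : W', w ∈ D'.support → IsDomain (W'.presheaf.stalk w) ∧
              ∀ d : ℕ, ringKrullDim (W'.presheaf.stalk w ⧸ stalkIdeal D' w) = d →
                ∀ t : Fin d → W'.presheaf.stalk w ⧸ stalkIdeal D' w,
                  (Ideal.span (Set.range t)).radical.IsMaximal →
                    RingTheory.Sequence.IsWeaklyRegular (W'.presheaf.stalk w ⧸ stalkIdeal D' w)
                      (List.ofFn t) ∧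
                    ∀ y : W'.presheaf.stalk w ⧸ stalkIdeal D' w, (∃ e : ℕ, y ^ p ^ e ∈
                      Ideal.span ((fun z : W'.presheaf.stalk w ⧸ stalkIdeal D' w => z ^ p ^ e) ''
                        (Ideal.span (Set.range t) :
                          Set (W'.presheaf.stalk w ⧸ stalkIdeal D' w)))) →
                      y ∈ Ideal.span (Set.range t)))
    (p : ℕ) [Fact p.Prime] (k : Type) [Field k] [CharP k p] (W : Scheme.{0})
    (g : W ⟶ Spec (.of k)) [IsSeparated g] [LocallyOfFiniteType g] [QuasiCompact g] [IsIntegral W]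
    (D : W.IdealSheafData) (hD : IsEffectiveCartier D)
    (hreg : ∀ w : W, w ∉ D.support → IsRegularLocalRing (W.presheaf.stalk w)) :
    ∃ (W' : Scheme.{0}) (π : W' ⟶ W), IsProper π ∧ IsBirational π ∧
      ∃ D' : W'.IdealSheafData, IsEffectiveCartier D' ∧
        (∀ w : W', w ∉ D'.support → IsRegularLocalRing (W'.presheaf.stalk w)) ∧
        (∀ w : W', w ∈ D'.support → IsDomain (W'.presheaf.stalk w) ∧
          ∀ d : ℕ, ringKrullDim (W'.presheaf.stalk w ⧸ stalkIdeal D' w) = d →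
            ∀ t : Fin d → W'.presheaf.stalk w ⧸ stalkIdeal D' w,
              (Ideal.span (Set.range t)).radical.IsMaximal →
                RingTheory.Sequence.IsWeaklyRegular (W'.presheaf.stalk w ⧸ stalkIdeal D' w)
                  (List.ofFn t) ∧
                ∀ y : W'.presheaf.stalk w ⧸ stalkIdeal D' w, (∃ e : ℕ, y ^ p ^ e ∈
                  Ideal.span ((fun z : W'.presheaf.stalk w ⧸ stalkIdeal D' w => z ^ p ^ e) ''
                    (Ideal.span (Set.range t) : Set (W'.presheaf.stalk w ⧸ stalkIdeal D' w)))) →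
                  y ∈ Ideal.span (Set.range t)) := by
  have hp : p.Prime := Fact.out
  -- (1) Macaulayfy `W`, by an isomorphism over its Cohen–Macaulay locus
  obtain ⟨W₁, π₁, hπ₁, hbir₁, hW₁, hCM₁, hisoU⟩ :=
    hM k W g inferInstance inferInstance inferInstance inferInstance
  haveI := hπ₁; haveI := hW₁
  haveI : IsDominant π₁ := hbir₁.isDominant
  -- (2) `π₁` is an isomorphism over `W ∖ Supp D`: regular stalks are Cohen–Macaulay
  haveI : IsIso (π₁ ∣_ D.support.compl) := by
    refine hisoU D.support.compl fun x hx d hd s hs => ?_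
    haveI : CharP (W.presheaf.stalk x) p := Negative.charP_stalk g x
    exact ((Negative.rungTwo_of_isRegularLocalRing hp _ (hreg x hx)).2 d hd s hs).1
  -- (3) the pulled-back boundary `D·𝒪_{W₁}` is effective Cartier and `W₁` is regular off it
  have hD₁ : IsEffectiveCartier (D.comap π₁) := hD.comap_of_isDominant π₁
  have hreg₁ : ∀ w : W₁, w ∉ (D.comap π₁).support → IsRegularLocalRing (W₁.presheaf.stalk w) := by
    intro w hw
    have hπw : π₁.base w ∉ (D.support : Set W) := by
      intro h
      apply hw
      rw [Scheme.IdealSheafData.support_comap]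
      exact h
    have hregw : IsRegularLocalRing (W.presheaf.stalk (π₁.base w)) := hreg _ hπw
    haveI : IsIso (π₁.stalkMap w) :=
      CmCartierHull.isIso_stalkMap_of_isIso_morphismRestrict π₁ D.support.compl w hπw
    exact IsRegularLocalRing.of_ringEquiv (asIso (π₁.stalkMap w)).commRingCatIsoToRingEquiv
  -- (4) the CM form on `(W₁, D·𝒪_{W₁})`, then compose
  obtain ⟨W', π', hπ', hbir', hrest⟩ := hFIH p k W₁ (π₁ ≫ g) hCM₁ (D.comap π₁) hD₁ hreg₁
  haveI := hπ'
  exact ⟨W', π' ≫ π₁, inferInstance, ComponentGluing.IsBirational.comp hbir' hbir₁, hrest⟩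

end Summit.ResolutionOfSingularities.ResolutionOfSingularities.Theorems.FRationalModification.MacaulayfyHull

end
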